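import Summits.HodgeConjecture.CorCM.MultiFieldWeilClosureDisjointSlots
import Summits.HodgeConjecture.CorCM.MultiFieldWeilNonIsomorphicOctics
import HarnessLib

/-!
# MULTI-FIELD WEIL ENGINE — THE MENU WITH IMPRIMITIVE QUARTIC SLOTS, `Hom = ∅` FORM: sextic, octic and decic CM fields through `k`, pairwise non-isomorphic within each
# degree, the `(1,3)`-fourfolds over ARBITRARY octic fields linearly disjoint from the other closures

Cell `pub-hodgecm2` (COR-CM), seat b30 gen 39 (2026-08-25); count-neutral own lane MULTI-FIELD WEIL ENGINE (stem `MultiFieldWeil*`), the `Hom = ∅` reading of Z5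
(`CorCM/MultiFieldWeilClosureDisjointSlots.lean`, `hodgeConjectureFor_biproduct_comp_of_sexticsOcticsDecics_imprimitive`) through W1 §3 (sextic pairs), Y1 §1 (decic pairs) and the
𝔖₄ lemma of `CorCM/MultiFieldWeilNonIsomorphicOctics.lean` (pairs of FLAGGED octic slots).  Theorems only; no definition, no named fact, no `sorry`.  HONEST FRAMING: conditional ONLY
on the two displayed binders `Markman2025_weilClasses_algebraic_abelianFourfold` and `Markman2025_weilClasses_algebraic_hyperbolicSixfold`; `HC_CM` is NOT proved and not asserted.

§1 `hodgeConjectureFor_biproduct_comp_of_sexticsOcticsDecics_imprimitive_of_isEmpty_ringHom` (+ dominated): `E` + any number of slots `(3,1)`, `(4,1)`, `(4,2)`, `(5,2)` over CM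
   fields through `k`, a flag `t` on the slots; (i) `2`-transitive `Aut(ℂ/τk)` on the `τ`-embeddings of every FLAGGED octic slot, the `(4,2)` slots flagged; (ii) `Hom(K_m, K_{m₀}) = ∅`
   for `m₀ ≠ m` both sextic, both decic, or both FLAGGED octic; (iii) a `τ`-embedding of `K_m` with a value outside `L(K_{m₀})` for `K_{m₀}` octic and `K_m` sextic, and for
   `K_{m₀}` UNFLAGGED octic and `K_m` FLAGGED octic; (iv) INTO every UNFLAGGED octic slot `m` (a `(1,3)`-fourfold over an octic field with ARBITRARY quartic part) from every
   `m₀ ≠ m`: one `τ`-embedding `s` with `[L(K_{m₀}) ⊔ ℚ(s(K_m)) : ℚ] = 4 [L(K_{m₀}) : ℚ]` ⟹ HC for EVERY product of copies and everything dominated.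
§2 `hodgeConjectureFor_biproduct_comp_of_weilFourfolds13_of_finrank_closure` (+ dominated): OCTIC FIELDS ONLY, NO GROUP HYPOTHESIS — `E` + any number of CM fourfolds of
   `k`-signature `(1,3)` over octic CM fields `K_m ∋ k` with ARBITRARY quartic parts, pairwise linearly disjoint from each other's Galois closures in the sense of (iv) ⟹ HC for
   every product of copies `E^a × ∏_m B_m^{b_m}`, GIVEN ONLY Markman's hyperbolic-sixfold theorem (gens 18–21 did ONE such fourfold with `E`).

[cite: Markman2025SurveySecant, Thm. 1.2] [cite: Markman2025SecantWeil, Thm 1.5.1] [cite: Pohlmann1968, Thm 1] [cite: MoonenZarhin1995Duke, Thm. 2.4] [cite: MumfordAV1970, §19]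
[cite: Lang2002, VI §1 Thm. 1.1, Cor. 1.6, Thm. 1.12 and V §2 Thm. 2.8] [cite: DixonMortimer1996, §1.4 Ex. 1.4.1–1.4.2, §1.6 Thm. 1.6A; §2.1; §3.3, Thm. 3.3A]
[cite: Dodson1984, §1.1 Imprimitivity Theorem and §5.1.2 Theorem] [cite: Shimura1998, §18.2 Lemma (i)]

## References
* [Markman2025SurveySecant] E. Markman, arXiv:2509.23403, Thm. 1.2.  [Markman2025SecantWeil] E. Markman, Cycles on abelian 2n-folds of Weil type from secant sheaves on abelian
  n-folds, Thm 1.5.1.  [Pohlmann1968] H. Pohlmann, Ann. of Math. 88 (1968), Thm 1.  [MoonenZarhin1995Duke] B. Moonen, Yu. Zarhin, Duke Math. J. 77 (1995), Thm. 2.4.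
  [MumfordAV1970] D. Mumford, *Abelian Varieties*, §19.  [Lang2002] S. Lang, *Algebra*, GTM 211, V §2, VI §1.  [DixonMortimer1996] J. D. Dixon, B. Mortimer, *Permutation
  Groups*, GTM 163, §1.4–§1.6, §2.1, §3.3.  [Dodson1984] B. Dodson, Trans. AMS 283 (1984), §1.1, §5.1.2.  [Shimura1998] G. Shimura, *Abelian varieties with complex
  multiplication and modular functions*, §18.2.
-/

noncomputable section

open CategoryTheory CategoryTheory.Limits NumberField IntermediateField

namespace Summit.HodgeConjecture.CorCM.MultiFieldWeil

open Finset
open Literature.AlgebraicGeometry Literature.AlgebraicGeometry.Motives Literature.AlgebraicGeometry.HodgeTheory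
open Literature.AlgebraicGeometry.ComplexMultiplication (IsCMTypeRealisation)
open Literature.AlgebraicTopology.SingularHomology
open Literature.NumberTheory.ComplexMultiplication
open Summit.HodgeConjecture.CorCM.Census.MultiFieldWeil

open scoped Classical

section Headline

variable {I : Type} {r : ℕ} {Kf : I → Type} [∀ i, Field (Kf i)] [∀ i, NumberField (Kf i)] [∀ i, IsCMField (Kf i)]
  {i₀ : I} {is : Fin r → I} {τ : Kf i₀ →+* ℂ}
  {A : Fin (r + 1) → AbelianVariety ℂ} {Φ : ∀ j : Fin (r + 1), CMType (Kf (mfSlots i₀ is j))}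
  {ι : ∀ j, 𝓞 (Kf (mfSlots i₀ is j)) →+* End (A j)}
  {θ : ∀ j, Kf (mfSlots i₀ is j) →+* Module.End ℂ (complexBetti (A j).X 1)}

/-! ## §1 The menu with imprimitive quartic slots, `Hom = ∅` form -/

/-- **HEADLINE — THE MENU WITH IMPRIMITIVE QUARTIC SLOTS, `Hom = ∅` FORM; GIVEN ONLY MARKMAN'S TWO THEOREMS.**  As `hodgeConjectureFor_biproduct_comp_of_sexticsOcticsDecics_imprimitive`
(Z5) with the closure hypothesis (ii) replaced by `Hom(K_m, K_{m₀}) = ∅` for the pairs `m₀ ≠ m` both sextic (W1 §3), both decic (Y1 §1) or both FLAGGED octic (the 𝔖₄ lemma); a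
`τ`-embedding with a value outside the closure is still asked for `K_{m₀}` octic, `K_m` sextic (cubic resolvent) and for `K_{m₀}` UNFLAGGED octic, `K_m` FLAGGED octic; INTO the
UNFLAGGED octic slots the degree hypothesis of Z5.  Then the Hodge conjecture holds for EVERY product of copies `⨁_j A(κ j)`.  `HC_CM` is NOT asserted.
[cite: Markman2025SurveySecant, Thm. 1.2] [cite: Markman2025SecantWeil, Thm 1.5.1] [cite: Pohlmann1968, Thm 1] [cite: MoonenZarhin1995Duke, Thm. 2.4] [cite: Lang2002, VI §1 Thm. 1.1, Cor. 1.6, Thm. 1.12]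
[cite: DixonMortimer1996, §1.4 Ex. 1.4.1–1.4.2; §2.1; §3.3, Thm. 3.3A] [cite: Dodson1984, §1.1 Imprimitivity Theorem and §5.1.2 Theorem] -/
theorem hodgeConjectureFor_biproduct_comp_of_sexticsOcticsDecics_imprimitive_of_isEmpty_ringHom (hW4 : Markman2025_weilClasses_algebraic_abelianFourfold)
    (hM6 : Markman2025_weilClasses_algebraic_hyperbolicSixfold) (n p : Fin r → ℕ) (t : Fin r → Prop)
    (hnp : ∀ m, (n m = 3 ∧ p m = 1) ∨ (n m = 4 ∧ p m = 1) ∨ (n m = 4 ∧ p m = 2 ∧ t m) ∨ (n m = 5 ∧ p m = 2))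
    {N : ℕ} (κ : Fin N → Fin (r + 1)) (h2 : Module.finrank ℚ (Kf i₀) = 2) (hdeg : ∀ m : Fin r, Module.finrank ℚ (Kf (is m)) = 2 * n m)
    (im : ∀ m : Fin r, Kf i₀ →+* Kf (is m)) (hA : ∀ j, IsCMTypeRealisation (Φ j) (A j) (ι j) (θ j)) (hΨ : ∀ σ : Kf i₀ →+* ℂ, σ ∈ (Φ 0).1 ↔ σ = τ)
    (hp : ∀ m : Fin r, (Finset.univ.filter fun s : Kf (is m) →+* ℂ => s.comp (im m) = τ ∧ s ∈ (Φ m.succ).1).card = p m)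
    (h2T : ∀ m : Fin r, n m = 4 → t m → ∀ s₁ s₂ s₁' s₂' : Kf (is m) →+* ℂ, s₁.comp (im m) = τ → s₂.comp (im m) = τ → s₁'.comp (im m) = τ →
      s₂'.comp (im m) = τ → s₁ ≠ s₂ → s₁' ≠ s₂' → ∃ ρ : ℂ ≃+* ℂ, (ρ : ℂ →+* ℂ).comp τ = τ ∧ (ρ : ℂ →+* ℂ).comp s₁ = s₁' ∧ (ρ : ℂ →+* ℂ).comp s₂ = s₂')
    (hiso : ∀ (m₀ m : Fin r), m₀ ≠ m → n m₀ = n m → (n m = 4 → t m ∧ t m₀) → IsEmpty (Kf (is m) →+* Kf (is m₀)))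
    (hout4 : ∀ (m₀ m : Fin r), m₀ ≠ m → n m₀ = 4 → (n m = 3 ∨ (n m = 4 ∧ t m ∧ ¬ t m₀)) →
      ∃ s : Kf (is m) →+* ℂ, s.comp (im m) = τ ∧ ∃ x, s x ∉ normalClosure ℚ (Kf (is m₀)) ℂ)
    (hdisj : ∀ (m₀ m : Fin r), m₀ ≠ m → n m = 4 → ¬ t m → ∃ s : Kf (is m) →+* ℂ, s.comp (im m) = τ ∧
      Module.finrank ℚ ↥(normalClosure ℚ (Kf (is m₀)) ℂ ⊔ adjoin ℚ (Set.range s)) = Module.finrank ℚ ↥(normalClosure ℚ (Kf (is m₀)) ℂ) * 4) :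
    HodgeConjectureFor (⨁ fun j => A (κ j)).dim (⨁ fun j => A (κ j)).X := by
  refine hodgeConjectureFor_biproduct_comp_of_sexticsOcticsDecics_imprimitive hW4 hM6 n p t hnp κ h2 hdeg im hA hΨ hp h2T (fun m₀ m hm hnm htm => ?_) hdisj
  -- a `τ`-embedding of `K_m`
  have hc := SexticOcticWeil.card_filter_comp_eq_of_finrank (n := n m) (im m) (hdeg m) h2 τ
  obtain ⟨s, hs⟩ := Finset.card_pos.1 (by rw [hc]; rcases hnp m with ⟨h, -⟩ | ⟨h, -⟩ | ⟨h, -⟩ | ⟨h, -⟩ <;> rw [h] <;> norm_num)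
  have hs' : s.comp (im m) = τ := (Finset.mem_filter.1 hs).2
  have hn : ∀ l, n l = 3 ∨ n l = 4 ∨ n l = 5 := fun l => by
    rcases hnp l with ⟨h, -⟩ | ⟨h, -⟩ | ⟨h, -⟩ | ⟨h, -⟩
    exacts [Or.inl h, Or.inr (Or.inl h), Or.inr (Or.inl h), Or.inr (Or.inr h)]
  rcases hnm with heq | ⟨h4₀, h3⟩
  · rcases hn m with h3 | h4 | h5
    · exact ⟨s, hs', exists_apply_not_mem_normalClosure_of_isEmpty_ringHom h2 im (by rw [hdeg m₀, heq, h3]) (by rw [hdeg m, h3])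
        (hiso m₀ m hm heq (fun h => by omega)) s hs'⟩
    · have h4₀ : n m₀ = 4 := heq.trans h4
      by_cases ht₀ : t m₀
      · exact exists_outside_normalClosure_of_isEmpty_ringHom_four h2 hdeg im m₀ m h4₀ h4 (h2T m₀ h4₀ ht₀) (hiso m₀ m hm heq fun _ => ⟨htm h4, ht₀⟩)
      · exact hout4 m₀ m hm h4₀ (Or.inr ⟨h4, htm h4, ht₀⟩)
    · exact ⟨s, hs', exists_apply_not_mem_normalClosure_of_isEmpty_ringHom_five h2 im (by rw [hdeg m₀, heq, h5]) (by rw [hdeg m, h5])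
        (hiso m₀ m hm heq (fun h => by omega)) s hs'⟩
  · exact hout4 m₀ m hm h4₀ (Or.inl h3)

/-- **Dominated form.** [cite: Markman2025SurveySecant, Thm. 1.2] [cite: Markman2025SecantWeil, Thm 1.5.1] [cite: MumfordAV1970, §19] -/
theorem hodgeConjectureFor_of_avDominatedBy_comp_of_sexticsOcticsDecics_imprimitive_of_isEmpty_ringHom (hW4 : Markman2025_weilClasses_algebraic_abelianFourfold)
    (hM6 : Markman2025_weilClasses_algebraic_hyperbolicSixfold) (n p : Fin r → ℕ) (t : Fin r → Prop)
    (hnp : ∀ m, (n m = 3 ∧ p m = 1) ∨ (n m = 4 ∧ p m = 1) ∨ (n m = 4 ∧ p m = 2 ∧ t m) ∨ (n m = 5 ∧ p m = 2))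
    {N : ℕ} (κ : Fin N → Fin (r + 1)) (h2 : Module.finrank ℚ (Kf i₀) = 2) (hdeg : ∀ m : Fin r, Module.finrank ℚ (Kf (is m)) = 2 * n m)
    (im : ∀ m : Fin r, Kf i₀ →+* Kf (is m)) (hA : ∀ j, IsCMTypeRealisation (Φ j) (A j) (ι j) (θ j)) (hΨ : ∀ σ : Kf i₀ →+* ℂ, σ ∈ (Φ 0).1 ↔ σ = τ)
    (hp : ∀ m : Fin r, (Finset.univ.filter fun s : Kf (is m) →+* ℂ => s.comp (im m) = τ ∧ s ∈ (Φ m.succ).1).card = p m)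
    (h2T : ∀ m : Fin r, n m = 4 → t m → ∀ s₁ s₂ s₁' s₂' : Kf (is m) →+* ℂ, s₁.comp (im m) = τ → s₂.comp (im m) = τ → s₁'.comp (im m) = τ →
      s₂'.comp (im m) = τ → s₁ ≠ s₂ → s₁' ≠ s₂' → ∃ ρ : ℂ ≃+* ℂ, (ρ : ℂ →+* ℂ).comp τ = τ ∧ (ρ : ℂ →+* ℂ).comp s₁ = s₁' ∧ (ρ : ℂ →+* ℂ).comp s₂ = s₂')
    (hiso : ∀ (m₀ m : Fin r), m₀ ≠ m → n m₀ = n m → (n m = 4 → t m ∧ t m₀) → IsEmpty (Kf (is m) →+* Kf (is m₀)))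
    (hout4 : ∀ (m₀ m : Fin r), m₀ ≠ m → n m₀ = 4 → (n m = 3 ∨ (n m = 4 ∧ t m ∧ ¬ t m₀)) →
      ∃ s : Kf (is m) →+* ℂ, s.comp (im m) = τ ∧ ∃ x, s x ∉ normalClosure ℚ (Kf (is m₀)) ℂ)
    (hdisj : ∀ (m₀ m : Fin r), m₀ ≠ m → n m = 4 → ¬ t m → ∃ s : Kf (is m) →+* ℂ, s.comp (im m) = τ ∧
      Module.finrank ℚ ↥(normalClosure ℚ (Kf (is m₀)) ℂ ⊔ adjoin ℚ (Set.range s)) = Module.finrank ℚ ↥(normalClosure ℚ (Kf (is m₀)) ℂ) * 4)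
    {X : AbelianVariety ℂ} (hX : Domination.AVDominatedBy X (⨁ fun j => A (κ j))) : HodgeConjectureFor X.dim X.X :=
  Domination.hodgeConjectureFor_of_avDominatedBy
    (hodgeConjectureFor_biproduct_comp_of_sexticsOcticsDecics_imprimitive_of_isEmpty_ringHom hW4 hM6 n p t hnp κ h2 hdeg im hA hΨ hp h2T hiso hout4 hdisj) hX

/-! ## §2 Octic fields only, no group hypothesis: `(1,3)`-fourfolds pairwise linearly disjoint from each other's closures -/

/-- **OCTIC FIELDS ONLY, ARBITRARY QUARTIC PARTS — ANY NUMBER OF CM FOURFOLDS OF `k`-SIGNATURE `(1,3)`, PAIRWISE LINEARLY DISJOINT FROM EACH OTHER'S GALOIS CLOSURES; GIVEN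
ONLY MARKMAN'S HYPERBOLIC-SIXFOLD THEOREM.**  `k = Kf i₀` imaginary quadratic, `E = A 0 ⊨ (k; {τ})`, `B_m = A (m+1) ⊨ (K_m; Φ (m+1))` over OCTIC CM fields `K_m ⊇ i_m(k)` with ONE
member of `Φ (m+1)` over `τ` (CM fourfolds of `k`-signature `(1,3)`), NO hypothesis on the Galois groups; for all `m₀ ≠ m` one `τ`-embedding `s` of `K_m` with
`[L(K_{m₀}) ⊔ ℚ(s(K_m)) : ℚ] = 4 · [L(K_{m₀}) : ℚ]`.  Then the Hodge conjecture holds for EVERY product of copies `E^a × ∏_m B_m^{b_m}` (the fourfold binder `hW4` is carried by the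
menu theorem but not used by these slots).  `HC_CM` is NOT asserted. [cite: Markman2025SecantWeil, Thm 1.5.1] [cite: Pohlmann1968, Thm 1] [cite: MoonenZarhin1995Duke, Thm. 2.4]
[cite: Lang2002, VI §1 Thm. 1.1, Cor. 1.6, Thm. 1.12 and V §2 Thm. 2.8] -/
theorem hodgeConjectureFor_biproduct_comp_of_weilFourfolds13_of_finrank_closure (hW4 : Markman2025_weilClasses_algebraic_abelianFourfold)
    (hM6 : Markman2025_weilClasses_algebraic_hyperbolicSixfold) {N : ℕ} (κ : Fin N → Fin (r + 1)) (h2 : Module.finrank ℚ (Kf i₀) = 2)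
    (h8 : ∀ m : Fin r, Module.finrank ℚ (Kf (is m)) = 8) (im : ∀ m : Fin r, Kf i₀ →+* Kf (is m)) (hA : ∀ j, IsCMTypeRealisation (Φ j) (A j) (ι j) (θ j))
    (hΨ : ∀ σ : Kf i₀ →+* ℂ, σ ∈ (Φ 0).1 ↔ σ = τ) (h1 : ∀ m : Fin r, (Finset.univ.filter fun s : Kf (is m) →+* ℂ => s.comp (im m) = τ ∧ s ∈ (Φ m.succ).1).card = 1)
    (hdisj : ∀ (m₀ m : Fin r), m₀ ≠ m → ∃ s : Kf (is m) →+* ℂ, s.comp (im m) = τ ∧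
      Module.finrank ℚ ↥(normalClosure ℚ (Kf (is m₀)) ℂ ⊔ adjoin ℚ (Set.range s)) = Module.finrank ℚ ↥(normalClosure ℚ (Kf (is m₀)) ℂ) * 4) :
    HodgeConjectureFor (⨁ fun j => A (κ j)).dim (⨁ fun j => A (κ j)).X :=
  hodgeConjectureFor_biproduct_comp_of_sexticsOcticsDecics_imprimitive hW4 hM6 (fun _ => 4) (fun _ => 1) (fun _ => False) (fun _ => Or.inr (Or.inl ⟨rfl, rfl⟩)) κ h2
    (fun m => by rw [h8 m]) im hA hΨ h1 (fun _ _ h => h.elim) (fun _ _ _ _ h => (h rfl).elim) fun m₀ m hm _ _ => hdisj m₀ m hm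

/-- **Dominated form, octic fields only.** [cite: Markman2025SecantWeil, Thm 1.5.1] [cite: MumfordAV1970, §19] -/
theorem hodgeConjectureFor_of_avDominatedBy_comp_of_weilFourfolds13_of_finrank_closure (hW4 : Markman2025_weilClasses_algebraic_abelianFourfold)
    (hM6 : Markman2025_weilClasses_algebraic_hyperbolicSixfold) {N : ℕ} (κ : Fin N → Fin (r + 1)) (h2 : Module.finrank ℚ (Kf i₀) = 2)
    (h8 : ∀ m : Fin r, Module.finrank ℚ (Kf (is m)) = 8) (im : ∀ m : Fin r, Kf i₀ →+* Kf (is m)) (hA : ∀ j, IsCMTypeRealisation (Φ j) (A j) (ι j) (θ j))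
    (hΨ : ∀ σ : Kf i₀ →+* ℂ, σ ∈ (Φ 0).1 ↔ σ = τ) (h1 : ∀ m : Fin r, (Finset.univ.filter fun s : Kf (is m) →+* ℂ => s.comp (im m) = τ ∧ s ∈ (Φ m.succ).1).card = 1)
    (hdisj : ∀ (m₀ m : Fin r), m₀ ≠ m → ∃ s : Kf (is m) →+* ℂ, s.comp (im m) = τ ∧
      Module.finrank ℚ ↥(normalClosure ℚ (Kf (is m₀)) ℂ ⊔ adjoin ℚ (Set.range s)) = Module.finrank ℚ ↥(normalClosure ℚ (Kf (is m₀)) ℂ) * 4)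
    {X : AbelianVariety ℂ} (hX : Domination.AVDominatedBy X (⨁ fun j => A (κ j))) : HodgeConjectureFor X.dim X.X :=
  Domination.hodgeConjectureFor_of_avDominatedBy (hodgeConjectureFor_biproduct_comp_of_weilFourfolds13_of_finrank_closure hW4 hM6 κ h2 h8 im hA hΨ h1 hdisj) hX

end Headline

end Summit.HodgeConjecture.CorCM.MultiFieldWeil

end
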